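/-
Copyright: lit-balaban Phase-2 proof seat p09 (gen 10).  Statement-level skeleton of a published paper; no proof claims beyond what
the kernel checks below.
-/
import Literature.MathematicalPhysics.QuantumFieldTheory.BalabanImbrieJaffe1984to88.BIJ88Sect2Statements

/-!
# [BalabanImbrieJaffe1985] (4.2.4) p. 310 / [BalabanImbrieJaffe1988] (2.2) p. 260: THE RUNNING CHARGE `e_k = e(L^kε)^{(4−d)/2}` GROWS
WITH THE NUMBER OF STEPS `k` (`d < 4`); at the last step `e_N = e`; only the number of REMAINING steps `N − k` is controlled by
`ln e_k⁻¹` — the arithmetic behind GAPS G-C1-05 ADDENDUM 7 SUPPLEMENT 3 (ERRATUM), kernel-checked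

T. Bałaban, J. Imbrie, A. Jaffe, *Renormalization of the Higgs model: minimizers, propagators and the stability of mean field theory*,
Commun. Math. Phys. **97** (1985) 299–329 [BalabanImbrieJaffe1985], and *Effective action and cluster properties of the abelian Higgs
model*, Commun. Math. Phys. **114** (1988) 257–315 [BalabanImbrieJaffe1988].  Rows **C1.Eq4.2.4-4.2.7** (owner r15) and **C2.Eq2.2**
(owner r18) of the lit-balaban skeleton; free-target protocol G.5-34(d) (seat p09 gen 10; companion of `BIJ85SecClosedIdxAllToriTwo`,
p313000, and of GAPS G-C1-05 ADDENDUM 7 SUPPLEMENT 3).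

THE PRINTED TEXT, verbatim.  [BalabanImbrieJaffe1985] p. 310 [PDF 12, text layer L29]: *"f^{(k)} = (ie_k)^{−1} ln v(∂p), where
e_k = e(L^kε)^{(4−d)/2}. (4.2.4)"*; p. 305 [PDF 7, L20] (2.24): *"where η = L^{−k}"*; p. 310 L32: *"a field f_k which lives on the
η = L^{−k} lattice"*.  [BalabanImbrieJaffe1988] p. 260 [PDF 4]: *"e_k = (L^kε)^{(4−d)/2}e, λ_k = (L^kε)^{4−d}λ, (2.2)"* — typed by r18 as
`BIJ88Sect2Statements.eK L ε e d k := (L^k·ε)^{(4−d)/2}·e` (REUSED here by name; nothing re-declared).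

WHY THIS FILE (located use).  The second printed form of (7.3.2) carries a line-sum constant `K_T` (p11's `SecClosedIdx.hT`); the tree
proves `K_T ≤ K₀·k` on two-dimensional tori (`BIJ85LineSumTkBound.exists_KT_linear_allTori`, p311403).  Its v1 header and GAPS G-C1-05
ADDENDUM 7 asserted that the factor `k` is harmless because *"k ≤ 2log(e_k⁻¹)/log L for e ≤ 1"*.  That inequality is BACKWARDS: with
`ε = L^{−N}` (`N` = total number of steps, `η = L^{−k}` after `k` of them) the printed (4.2.4) gives `ln e_k⁻¹ = ln e⁻¹ +
((4−d)/2)(N−k)·ln L`, so `e_k` INCREASES with `k`, equals `e` at `k = N`, and it is `N − k` — the remaining steps — that is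
`≤ 2ln(e_k⁻¹)/((4−d)ln L)`; at the last step `2ln(e_N⁻¹)/ln L = 2ln(e⁻¹)/ln L` does not depend on `N` at all, so it cannot dominate
`k = N`.  This file kernel-checks exactly these statements for r18's `eK`; the consequence (the k-UNIFORM `K_T` is NECESSARY for the
printed use of (7.3.2)) is recorded in GAPS G-C1-05 ADDENDUM 7 SUPPLEMENT 3 and in the v1.1 headers of `BIJ85LineSumTkBound` /
`BIJ85SecClosedIdxAllToriTwo`.

WHAT IS PROVED (0 `sorry`, theorems only, elementary real analysis on the printed formula):
* `eK_pos`; `eK_lt_succ`, `eK_strictMono` (`d < 4`, `L > 1`, `ε > 0`, `e > 0`: `k ↦ e_k` strictly increasing); `eK_le_last`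
  (`e_k ≤ e_N = e` for `k ≤ N` at `L^Nε = 1`), `eK_last` (`e_N = e`);
* `log_inv_eK` (`ln e_k⁻¹ = ln e⁻¹ + ((4−d)/2)·(N−k)·ln L` for `ε = (L^N)⁻¹`, `k ≤ N`), `log_inv_eK_last` (`ln e_N⁻¹ = ln e⁻¹`);
* `remaining_steps_le` (`e ≤ 1`: `N − k ≤ 2ln(e_k⁻¹)/((4−d)ln L)`) — the TRUE relation;
* `not_last_step_le_log` (the asserted `k ≤ 2ln(e_k⁻¹)/ln L` FAILS at `k = N ≥ 1`, `e = 1`: the right side is `0`).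
HONEST SCOPE.  Arithmetic of the printed formula only; `ε = L^{−N}` is the reading "unit physical volume after `N` steps" (the paper
fixes `L^kε ≤ 1` implicitly: `e_k ≤ e`); nothing about the renormalization flow itself is claimed; nothing printed is contradicted.

statement-level skeleton of published theorems with citation tags; proofs where landed; nothing here is a claim about the Yang–Mills mass gap
-/

namespace Literature.MathematicalPhysics.QuantumFieldTheory.BalabanImbrieJaffe1984to88.BIJ88Eq22RunningCharge

open BIJ88Sect2Statements (eK)

noncomputable section

/-- kernel: `e_k > 0`. [cite: BalabanImbrieJaffe1985, (4.2.4) p.310] -/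
theorem eK_pos {L ε e : ℝ} (hL : 0 < L) (hε : 0 < ε) (he : 0 < e) (d k : ℕ) : 0 < eK L ε e d k := by
  unfold eK
  exact mul_pos (Real.rpow_pos_of_pos (mul_pos (pow_pos hL k) hε) _) he

/-- **`e_k < e_{k+1}`**: for `d < 4`, `L > 1`, `ε > 0`, `e > 0` the running charge (4.2.4) grows with the number of steps.
[cite: BalabanImbrieJaffe1985, (4.2.4) p.310] -/
theorem eK_lt_succ {L ε e : ℝ} (hL : 1 < L) (hε : 0 < ε) (he : 0 < e) {d : ℕ} (hd : d < 4) (k : ℕ) :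
    eK L ε e d k < eK L ε e d (k + 1) := by
  unfold eK
  have hL0 : 0 < L := by linarith
  have hd' : (d : ℝ) < 4 := by exact_mod_cast hd
  have hs : 0 < (4 - (d : ℝ)) / 2 := by linarith
  have hlt : L ^ k * ε < L ^ (k + 1) * ε := by
    rw [pow_succ]
    have h1 : L ^ k * ε < L ^ k * L * ε := by nlinarith [pow_pos hL0 k, mul_pos (pow_pos hL0 k) hε]
    exact h1
  exact mul_lt_mul_of_pos_right (Real.rpow_lt_rpow (by positivity) hlt hs) he

/-- **`k ↦ e_k` is strictly increasing** (`d < 4`). [cite: BalabanImbrieJaffe1985, (4.2.4) p.310] -/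
theorem eK_strictMono {L ε e : ℝ} (hL : 1 < L) (hε : 0 < ε) (he : 0 < e) {d : ℕ} (hd : d < 4) :
    StrictMono fun k => eK L ε e d k :=
  strictMono_nat_of_lt_succ fun k => eK_lt_succ hL hε he hd k

/-- **`e_N = e` at the last step** (`L^Nε = 1`). [cite: BalabanImbrieJaffe1985, (4.2.4) p.310] -/
theorem eK_last {L ε : ℝ} {N : ℕ} (h : L ^ N * ε = 1) (e : ℝ) (d : ℕ) : eK L ε e d N = e := by
  unfold eK
  rw [h, Real.one_rpow, one_mul]

/-- **`e_k ≤ e_N = e`** for `k ≤ N` (`d < 4`, `L > 1`, `ε = (L^N)⁻¹`, `e > 0`). [cite: BalabanImbrieJaffe1985, (4.2.4) p.310] -/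
theorem eK_le_last {L e : ℝ} (hL : 1 < L) (he : 0 < e) {d : ℕ} (hd : d < 4) {k N : ℕ} (hk : k ≤ N) :
    eK L ((L ^ N)⁻¹) e d k ≤ e := by
  have hL0 : 0 < L := by linarith
  have hε : 0 < (L ^ N)⁻¹ := inv_pos.2 (pow_pos hL0 N)
  have h := (eK_strictMono hL hε he hd).monotone hk
  have hlast : eK L ((L ^ N)⁻¹) e d N = e := eK_last (mul_inv_cancel₀ (pow_pos hL0 N).ne') e d
  simpa only [hlast] using h

/-- **`ln e_k⁻¹ = ln e⁻¹ + ((4−d)/2)·(N−k)·ln L`** for `ε = (L^N)⁻¹` and `k ≤ N`. [cite: BalabanImbrieJaffe1985, (4.2.4) p.310] -/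
theorem log_inv_eK {L e : ℝ} (hL : 0 < L) (he : 0 < e) (d : ℕ) {k N : ℕ} (hk : k ≤ N) :
    Real.log (eK L ((L ^ N)⁻¹) e d k)⁻¹ =
      Real.log e⁻¹ + (4 - (d : ℝ)) / 2 * ((N - k : ℕ) : ℝ) * Real.log L := by
  unfold eK
  have hx0 : 0 < L ^ (N - k) := pow_pos hL _
  have hLN : L ^ k * (L ^ N)⁻¹ = (L ^ (N - k))⁻¹ := by
    rw [pow_sub₀ L hL.ne' hk, mul_inv, inv_inv, mul_comm]
  have hx : 0 < (L ^ (N - k))⁻¹ := inv_pos.2 hx0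
  rw [hLN, mul_inv, Real.log_mul (inv_ne_zero (Real.rpow_pos_of_pos hx _).ne') (inv_ne_zero he.ne'),
    ← Real.rpow_neg_one ((L ^ (N - k))⁻¹ ^ ((4 - (d : ℝ)) / 2)), ← Real.rpow_mul hx.le,
    Real.log_rpow hx, Real.log_inv, Real.log_pow]
  ring

/-- **at the last step `ln e_N⁻¹ = ln e⁻¹`** — independent of `N`. [cite: BalabanImbrieJaffe1985, (4.2.4) p.310] -/
theorem log_inv_eK_last {L e : ℝ} (hL : 0 < L) (he : 0 < e) (d N : ℕ) :
    Real.log (eK L ((L ^ N)⁻¹) e d N)⁻¹ = Real.log e⁻¹ := by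
  rw [log_inv_eK hL he d le_rfl, Nat.sub_self]
  simp

/-- **THE TRUE RELATION: the number of REMAINING steps is controlled by `ln e_k⁻¹`** — for `e ≤ 1`, `d < 4`, `L > 1`, `ε = (L^N)⁻¹`,
`k ≤ N`: `N − k ≤ 2ln(e_k⁻¹)/((4−d)ln L)`. [cite: BalabanImbrieJaffe1985, (4.2.4) p.310] -/
theorem remaining_steps_le {L e : ℝ} (hL : 1 < L) (he : 0 < e) (he1 : e ≤ 1) {d : ℕ} (hd : d < 4) {k N : ℕ} (hk : k ≤ N) :
    ((N - k : ℕ) : ℝ) ≤ 2 * Real.log (eK L ((L ^ N)⁻¹) e d k)⁻¹ / ((4 - (d : ℝ)) * Real.log L) := by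
  have hL0 : 0 < L := by linarith
  have hlogL : 0 < Real.log L := Real.log_pos hL
  have hd' : (d : ℝ) < 4 := by exact_mod_cast hd
  have h4d : 0 < (4 - (d : ℝ)) * Real.log L := mul_pos (by linarith) hlogL
  have hle : 0 ≤ Real.log e⁻¹ := Real.log_nonneg (one_le_inv_iff₀.2 ⟨he, he1⟩)
  rw [log_inv_eK hL0 he d hk, le_div_iff₀ h4d]
  nlinarith [Nat.cast_nonneg (α := ℝ) (N - k)]

/-- **THE ASSERTED RELATION FAILS**: at the last step `k = N ≥ 1` with `e = 1` (and `ε = (L^N)⁻¹`), `2ln(e_N⁻¹)/ln L = 0 < N`, so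
`k ≤ 2ln(e_k⁻¹)/ln L` is false there — the factor `k` of a linear-in-`k` constant is not dominated by a power of `ln e_k⁻¹`.
[cite: BalabanImbrieJaffe1985, (4.2.4) p.310] -/
theorem not_last_step_le_log {L : ℝ} (hL : 1 < L) (d : ℕ) {N : ℕ} (hN : 1 ≤ N) :
    ¬ ((N : ℝ) ≤ 2 * Real.log (eK L ((L ^ N)⁻¹) 1 d N)⁻¹ / Real.log L) := by
  have hL0 : 0 < L := by linarith
  rw [log_inv_eK_last hL0 one_pos d N, inv_one, Real.log_one, mul_zero, zero_div, not_le]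
  exact_mod_cast hN

end

end Literature.MathematicalPhysics.QuantumFieldTheory.BalabanImbrieJaffe1984to88.BIJ88Eq22RunningCharge
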